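import Summits.AtomisticToContinuum.HydrodynamicLimit.Theorems.ImplosionDichotomyHydroLimitInBandWindowBalance
import Summits.AtomisticToContinuum.HydrodynamicLimit.Theorems.OneFlightGossipEngineClampedCurrentsDockPathwise
import Literature.Analysis.FluidPDE.EmpiricalCollisionMeasureMeasurableLabels
import Literature.Analysis.FluidPDE.CollisionalTransferFunctionalMeasurable
import Literature.MathematicalPhysics.KineticTheory.HardSphereEulerProofs
import HarnessLib

/-!
# The one-window entropy balance with a time-dependent local Gibbs reference (stub `stub_windowBalance`)

Crux `Summit.AtomisticToContinuum.HydrodynamicLimit.Theses.OneFlightGossipEngine.ClampedCurrentsDock`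
(stmt-AtomisticToContinuum-14680), line `IdeatorTwoSketch`, registered stub C0 `stub_windowBalance : WindowBalance`
(re-declared verbatim from the line skeleton): Yau's one-window entropy balance as an EXACT finite-`N` identity,
`KL(f_{s+h} ‖ ψ_{s+h}) − KL(f_s ‖ ψ_s) = −E_λ[Str + Col] + log Z_pos(a_{s+h}) − log Z_pos(a_s)` with the moving
reference `ψ_r = localGibbsLaw σ (a r) (u r) (θ r)`, `Str`/`Col` the (integrable) streaming integral / collision sum
of the one-body exponent: explicit entropies (`EntropyClockDock.toReal_klDiv_lawAt_eq_integral`) at the two times,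
the pathwise identity `ClampedCurrentsDockPathwise.gSum_sub_eq` on the good set, measurability of `Col` as a collision
sum of a continuous mark function, domination of `Str = ΔG − Col` (`|Dg_r(x, v)| ≤ C (1 + |v|)³`, energy, moments).
References: H.-T. Yau, Lett. Math. Phys. 22 (1991) §2; H. Spohn, *Large Scale Dynamics* (1991), Part I §3.2.
-/

noncomputable section

open MeasureTheory Filter Set Topology InformationTheory
open scoped ENNReal InnerProductSpace

namespace Summit.AtomisticToContinuum.HydrodynamicLimit.Theorems.ClampedCurrentsDockWindowBalance

open Literature.MathematicalPhysics.KineticTheory Literature.Analysis.FluidPDE Literature.Analysis.FunctionSpaces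
open ClampedCurrentsDockPathwise (gExp DgExp gSum DgSum pairKernel isSmoothSpaceTimeOn_gExp gSum_sub_eq)
open EntropyClockDock (ae_mem_good_localGibbsLaw integrable_sum_norm_sq_localGibbsLaw
  integrable_oneBodySum_flow integrable_oneBodySum toReal_klDiv_lawAt_eq_integral)

/-- registered stub signature C0 of line IdeatorTwoSketch, crux ClampedCurrentsDock — route-internal, not a cited fact -/
def WindowBalance : Prop :=
  ∀ (σ T : ℝ) (N : ℕ) (Φ : HardSphereFlow (Torus.geometry (Fin 3)) (hsDiameter σ N) (N + 1))
    (a₀ θ₀ : T3 → ℝ) (u₀ : T3 → V3) (a θ : ℝ → T3 → ℝ) (u : ℝ → T3 → V3),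
    0 < σ → σ < 1 / 2 → Continuous a₀ → Continuous θ₀ → Continuous u₀ → (∀ x, 0 < a₀ x) → (∀ x, 0 < θ₀ x) →
    Torus.IsSmoothSpaceTimeOn (Ico 0 T) a → Torus.IsSmoothSpaceTimeOn (Ico 0 T) θ →
    Torus.IsSmoothSpaceTimeOn (Ico 0 T) u →
    (∀ t ∈ Ico 0 T, ∀ x, 0 < a t x) → (∀ t ∈ Ico 0 T, ∀ x, 0 < θ t x) →
    ∀ s h : ℝ, 0 ≤ s → 0 ≤ h → s + h < T →
      (let g := fun (t : ℝ) (y : T3 × V3) =>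
         Real.log (a t y.1) - 3 / 2 * Real.log (2 * Real.pi * θ t y.1) - ‖y.2 - u t y.1‖ ^ 2 / (2 * θ t y.1)
       let Dg := fun (t : ℝ) (y : T3 × V3) =>
         Torus.timeDerivWithin (Ico 0 T) (fun t' x => g t' (x, y.2)) t y.1 +
           ∑ k : Fin 3, y.2 k * Torus.partialDeriv k (fun x => g t (x, y.2)) y.1
       let Str := fun (z : Config (N + 1) (Fin 3) T3) =>
         ∫ r in s..(s + h), ∑ i : Fin (N + 1), Dg r ((Φ.flow r z) i)
       let Col := fun (z : Config (N + 1) (Fin 3) T3) =>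
         Φ.collisionSum (Set.Ioc s (s + h)) (fun c =>
             ((∑ k : Fin 3, (u c.time c.fstPos k / θ c.time c.fstPos - u c.time c.sndPos k / θ c.time c.sndPos) *
                 (c.postVel.1 k - c.preVel.1 k)) -
               ((θ c.time c.fstPos)⁻¹ - (θ c.time c.sndPos)⁻¹) * ((‖c.postVel.1‖ ^ 2 - ‖c.preVel.1‖ ^ 2) / 2)) / 2) z
       let P := localGibbsLaw σ a₀ u₀ θ₀ N Φ
       Integrable Str P ∧ Integrable Col P ∧
       (klDiv (Φ.lawAt P (s + h)) (localGibbsLaw σ (a (s + h)) (u (s + h)) (θ (s + h)) N Φ)).toReal -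
           (klDiv (Φ.lawAt P s) (localGibbsLaw σ (a s) (u s) (θ s) N Φ)).toReal =
         -(∫ z, (Str z + Col z) ∂P) +
           (Real.log (posPartition (a (s + h)) (hsDiameter σ N) (N + 1)) -
             Real.log (posPartition (a s) (hsDiameter σ N) (N + 1))))

/-! ## §1 Fourth velocity moments under the local Gibbs law -/

/-- **Fourth velocity moments are finite under the local Gibbs law**, `E_λ[Σ_i |v_i|⁴] < ∞` (Gaussian velocities
given the positions: `integral_norm_pow_four_gaussMeasure_le`, `lintegral_meanVelObs_localGibbsMeasure_le`). [folklore] -/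
theorem integrable_sum_norm_pow_four_localGibbsLaw {a₀ θ₀ : T3 → ℝ} {u₀ : T3 → V3} (ha : Continuous a₀)
    (hθ : Continuous θ₀) (hu : Continuous u₀) (ha0 : ∀ x, 0 ≤ a₀ x) (hθ0 : ∀ x, 0 < θ₀ x) (σ : ℝ) (N : ℕ)
    (Φ : HardSphereFlow (Torus.geometry (Fin 3)) (hsDiameter σ N) (N + 1)) :
    Integrable (fun z : Config (N + 1) (Fin 3) T3 => ∑ i, ‖(z i).2‖ ^ 4) (localGibbsLaw σ a₀ u₀ θ₀ N Φ) := by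
  obtain ⟨U, -, hU⟩ := exists_forall_abs_le_of_continuous (χ := fun x => ‖u₀ x‖) hu.norm
  obtain ⟨Θ, -, hΘ⟩ := exists_forall_abs_le_of_continuous hθ
  have hK : 0 ≤ ∫ w, ‖w‖ ^ 4 ∂ProbabilityTheory.stdGaussian V3 := integral_nonneg fun w => by positivity
  have hmean : Integrable (fun z : Config (N + 1) (Fin 3) T3 =>
      ((N : ℝ) + 1)⁻¹ * ∑ i, ‖(z i).2‖ ^ 4) (localGibbsLaw σ a₀ u₀ θ₀ N Φ) := by
    refine ⟨(by fun_prop : Measurable fun z : Config (N + 1) (Fin 3) T3 =>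
      ((N : ℝ) + 1)⁻¹ * ∑ i, ‖(z i).2‖ ^ 4).aestronglyMeasurable, ?_⟩
    rw [hasFiniteIntegral_iff_ofReal (Eventually.of_forall fun z => by simp only [Pi.zero_apply]; positivity)]
    refine lt_of_le_of_lt (b := ENNReal.ofReal
      (8 * (U ^ 4 + Θ ^ 2 * ∫ w, ‖w‖ ^ 4 ∂ProbabilityTheory.stdGaussian V3))) ?_ ENNReal.ofReal_lt_top
    rw [localGibbsLaw_eq]
    refine lintegral_meanVelObs_localGibbsMeasure_le ha hθ hu ha0 hθ0 (f := fun v : V3 => ‖v‖ ^ 4)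
      (by fun_prop) (fun v => by positivity) (fun y => ?_) σ N
    rw [← ofReal_integral_eq_lintegral_ofReal (integrable_norm_pow_four_gaussMeasure (u₀ y) (θ₀ y))
      (Eventually.of_forall fun v => by positivity)]
    refine ENNReal.ofReal_le_ofReal ((integral_norm_pow_four_gaussMeasure_le (u₀ y) (hθ0 y)).trans ?_)
    have h1 : ‖u₀ y‖ ≤ U := by simpa only [abs_of_nonneg (norm_nonneg _)] using hU y
    have h3 : ‖u₀ y‖ ^ 4 ≤ U ^ 4 := pow_le_pow_left₀ (norm_nonneg _) h1 4
    have h4 : θ₀ y ^ 2 ≤ Θ ^ 2 := pow_le_pow_left₀ (hθ0 y).le ((le_abs_self _).trans (hΘ y)) 2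
    nlinarith [mul_le_mul_of_nonneg_right h4 hK]
  refine (hmean.const_mul ((N : ℝ) + 1)).congr (Eventually.of_forall fun z => ?_)
  simp only
  rw [← mul_assoc, mul_inv_cancel₀ (by positivity), one_mul]

/-! ## §2 The streaming rate grows at most cubically in the velocity -/

section Streaming

variable {T : ℝ} {a θ : ℝ → T3 → ℝ} {u : ℝ → T3 → V3}

/-- The lifted space–time derivative of a jointly smooth field is bounded over `K × T³` for compact `K ⊆ S`
(continuity of `ContDiffOn.fderivWithin` on the compact `K × [0,1]³`). [folklore] -/
theorem exists_norm_fderivWithin_stLift_le {F : Type*} [NormedAddCommGroup F] [NormedSpace ℝ F]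
    {S : Set ℝ} {ψ : ℝ → T3 → F} (hψ : Torus.IsSmoothSpaceTimeOn S ψ) (hS : UniqueDiffOn ℝ S)
    {K : Set ℝ} (hK : IsCompact K) (hKS : K ⊆ S) :
    ∃ C : ℝ, 0 ≤ C ∧ ∀ t ∈ K, ∀ x : T3, ‖fderivWithin ℝ (Torus.stLift ψ) (S ×ˢ univ) (t, Torus.repr x)‖ ≤ C := by
  have hc : ContinuousOn (fderivWithin ℝ (Torus.stLift ψ) (S ×ˢ univ))
      (K ×ˢ ((WithLp.toLp 2) '' (Set.pi univ fun _ : Fin 3 => Icc (0 : ℝ) 1))) :=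
    (hψ.continuousOn_fderivWithin (hS.prod uniqueDiffOn_univ) (by simp)).mono (prod_mono hKS (subset_univ _))
  obtain ⟨C, hC⟩ := (hK.prod Torus.isCompact_toLp_image_pi_Icc).exists_bound_of_continuousOn hc
  exact ⟨max C 0, le_max_right _ _, fun t ht x =>
    (hC _ (mk_mem_prod ht (Torus.repr_mem_toLp_image_pi_Icc x))).trans (le_max_left _ _)⟩

/-- **The streaming rate grows at most cubically in the velocity, uniformly on a compact window**: for profiles
jointly smooth on `[0, T)` with `a, θ > 0` and `[s, s+h] ⊆ [0, T)`, `|Dg_t(x, v)| ≤ C (1 + |v|)³` on `[s, s+h]`: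
`g = g(·, 0) + ⟪v, u/θ⟫ + |v|²(−1/(2θ))` has jointly smooth coefficients and `Dg_t(x, v)` is the space–time derivative
of its lift in the direction `(1, v)`, whose three pieces have bounded operator norms on `[s, s+h] × [0,1]³`. [folklore] -/
theorem exists_abs_DgExp_le (ha : Torus.IsSmoothSpaceTimeOn (Ico 0 T) a)
    (hθ : Torus.IsSmoothSpaceTimeOn (Ico 0 T) θ) (hu : Torus.IsSmoothSpaceTimeOn (Ico 0 T) u)
    (ha0 : ∀ t ∈ Ico 0 T, ∀ x, 0 < a t x) (hθ0 : ∀ t ∈ Ico 0 T, ∀ x, 0 < θ t x) {s h : ℝ}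
    (hs : 0 ≤ s) (hshT : s + h < T) :
    ∃ C : ℝ, 0 ≤ C ∧ ∀ t ∈ Icc s (s + h), ∀ y : T3 × V3, |DgExp T a θ u t y| ≤ C * (1 + ‖y.2‖) ^ 3 := by
  have hU : UniqueDiffOn ℝ (Ico (0 : ℝ) T) := uniqueDiffOn_Ico 0 T
  have hU' : UniqueDiffOn ℝ (Ico (0 : ℝ) T ×ˢ (univ : Set V3)) := hU.prod uniqueDiffOn_univ
  have hKS : Icc s (s + h) ⊆ Ico 0 T := fun r hr => ⟨hs.trans hr.1, hr.2.trans_lt hshT⟩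
  -- the coefficients `J = u/θ`, `μ = −1/(2θ)` and the decomposition of the exponent
  set J : ℝ → T3 → V3 := fun t x => (θ t x)⁻¹ • u t x with hJ_def
  set μ : ℝ → T3 → ℝ := fun t x => -(2 * θ t x)⁻¹ with hμ_def
  have hpoly : ∀ (t : ℝ) (x : T3) (v : V3),
      gExp a θ u t (x, v) = gExp a θ u t (x, 0) + ⟪v, J t x⟫_ℝ + ‖v‖ ^ 2 • μ t x := fun t x v => by
    simp only [gExp, hJ_def, hμ_def, zero_sub, norm_neg, real_inner_smul_right, smul_eq_mul]
    rw [norm_sub_sq_real]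
    ring
  have hθ' : ∀ p ∈ Ico 0 T ×ˢ (univ : Set V3), Torus.stLift θ p ≠ 0 := fun p hp =>
    (hθ0 p.1 hp.1 (Torus.proj p.2)).ne'
  have hJ : Torus.IsSmoothSpaceTimeOn (Ico 0 T) J := by
    show ContDiffOn ℝ _ (fun p : ℝ × V3 => (Torus.stLift θ p)⁻¹ • Torus.stLift u p) (Ico 0 T ×ˢ univ)
    exact (ContDiffOn.inv hθ hθ').smul hu
  have hμ : Torus.IsSmoothSpaceTimeOn (Ico 0 T) μ := by
    show ContDiffOn ℝ _ (fun p : ℝ × V3 => -(2 * Torus.stLift θ p)⁻¹) (Ico 0 T ×ˢ univ)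
    exact (ContDiffOn.inv (contDiffOn_const.mul hθ) fun p hp => mul_ne_zero two_ne_zero (hθ' p hp)).neg
  have hg := fun v : V3 => isSmoothSpaceTimeOn_gExp ha hθ hu ha0 hθ0 v
  obtain ⟨C₀, hC₀, h0⟩ := exists_norm_fderivWithin_stLift_le (hg 0) hU isCompact_Icc hKS
  obtain ⟨C₁, hC₁, h1⟩ := exists_norm_fderivWithin_stLift_le hJ hU isCompact_Icc hKS
  obtain ⟨C₂, hC₂, h2⟩ := exists_norm_fderivWithin_stLift_le hμ hU isCompact_Icc hKS
  refine ⟨C₀ + C₁ + C₂, by positivity, fun t ht y => ?_⟩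
  obtain ⟨x, v⟩ := y
  have htS : t ∈ Ico 0 T := hKS ht
  have hmem : (t, Torus.repr x) ∈ Ico 0 T ×ˢ (univ : Set V3) := mk_mem_prod htS (mem_univ _)
  set L₀ := fderivWithin ℝ (Torus.stLift fun t' x' => gExp a θ u t' (x', 0)) (Ico 0 T ×ˢ univ) (t, Torus.repr x)
  set L₁ := fderivWithin ℝ (Torus.stLift J) (Ico 0 T ×ˢ univ) (t, Torus.repr x)
  set L₂ := fderivWithin ℝ (Torus.stLift μ) (Ico 0 T ×ˢ univ) (t, Torus.repr x)
  -- (a) the streaming rate is the space–time derivative of the lifted exponent in the direction `(1, v)`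
  have hDg : DgExp T a θ u t (x, v) =
      fderivWithin ℝ (Torus.stLift fun t' x' => gExp a θ u t' (x', v)) (Ico 0 T ×ˢ univ) (t, Torus.repr x) (1, v) := by
    conv_lhs => rw [← Torus.proj_repr x]
    dsimp only [DgExp]
    rw [show ((1 : ℝ), v) = ((1 : ℝ), (0 : V3)) + ((0 : ℝ), v) by simp, map_add, (hg v).timeDerivWithin_apply_proj hU
      htS, ← (hg v).fderiv_slice_apply htS, Torus.fderiv_apply_eq_sum_partialDeriv (((hg v).isSmooth_slice
      htS).isContDiff (by simp))]
    simp only [smul_eq_mul]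
  -- (b) the derivative splits along the decomposition of the exponent
  have hsplitD : fderivWithin ℝ (Torus.stLift fun t' x' => gExp a θ u t' (x', v)) (Ico 0 T ×ˢ univ)
      (t, Torus.repr x) = L₀ + (innerSL ℝ v).comp L₁ + ‖v‖ ^ 2 • L₂ := by
    have d0 := ((hg 0).differentiableOn (by simp) _ hmem).hasFDerivWithinAt
    have dJ := (hJ.differentiableOn (by simp) _ hmem).hasFDerivWithinAt
    have dμ := (hμ.differentiableOn (by simp) _ hmem).hasFDerivWithinAt
    refine (((d0.add ((innerSL ℝ v).hasFDerivAt.comp_hasFDerivWithinAt _ dJ)).add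
      (dμ.const_smul (‖v‖ ^ 2))).congr' (fun p _ => ?_) hmem).fderivWithin (hU' _ hmem)
    simp only [Pi.add_apply, Pi.smul_apply, Function.comp_apply, Torus.stLift, innerSL_apply_apply]
    exact hpoly p.1 (Torus.proj p.2) v
  have hv0 : 0 ≤ ‖v‖ := norm_nonneg v
  have hn : ‖((1 : ℝ), v)‖ ≤ 1 + ‖v‖ := by rw [Prod.norm_def]; exact max_le (by simp) (by simp)
  have hL : ‖L₀ + (innerSL ℝ v).comp L₁ + ‖v‖ ^ 2 • L₂‖ ≤ C₀ + ‖v‖ * C₁ + ‖v‖ ^ 2 * C₂ := by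
    refine norm_add₃_le.trans (add_le_add (add_le_add (h0 t ht x) ?_) ?_)
    · refine (ContinuousLinearMap.opNorm_comp_le _ _).trans ?_
      rw [innerSL_apply_norm]
      exact mul_le_mul_of_nonneg_left (h1 t ht x) hv0
    · rw [norm_smul, Real.norm_of_nonneg (sq_nonneg _)]
      exact mul_le_mul_of_nonneg_left (h2 t ht x) (sq_nonneg _)
  rw [hDg, hsplitD, ← Real.norm_eq_abs]
  refine (ContinuousLinearMap.le_opNorm _ _).trans ?_
  calc _ ≤ (C₀ + ‖v‖ * C₁ + ‖v‖ ^ 2 * C₂) * (1 + ‖v‖) := mul_le_mul hL hn (norm_nonneg _) (by positivity)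
    _ ≤ (C₀ + C₁ + C₂) * (1 + ‖v‖) ^ 3 := by
        nlinarith [mul_nonneg hC₀ hv0, mul_nonneg hC₁ hv0, mul_nonneg hC₂ hv0,
          mul_nonneg (mul_nonneg hC₀ hv0) hv0, mul_nonneg (mul_nonneg hC₁ hv0) hv0,
          mul_nonneg (mul_nonneg hC₂ hv0) hv0, mul_nonneg (mul_nonneg (mul_nonneg hC₀ hv0) hv0) hv0,
          mul_nonneg (mul_nonneg (mul_nonneg hC₁ hv0) hv0) hv0]

/-- **Summed over the particles**: `|Σ_i Dg_r(w_i)| ≤ (N+1) C (3 + 5E + E²)`, `E = Σ_i |v_i|²` (`|v_i| ≤ √E`,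
`(1 + √E)³ ≤ 3 + 5E + E²`). [folklore] -/
theorem abs_DgSum_le {N : ℕ} {r C : ℝ} (hC0 : 0 ≤ C)
    (hC : ∀ y : T3 × V3, |DgExp T a θ u r y| ≤ C * (1 + ‖y.2‖) ^ 3) (w : Config (N + 1) (Fin 3) T3) :
    |DgSum T a θ u r w| ≤ ((N : ℝ) + 1) * C * (3 + 5 * ∑ i, ‖(w i).2‖ ^ 2 + (∑ i, ‖(w i).2‖ ^ 2) ^ 2) := by
  set E := ∑ i, ‖(w i).2‖ ^ 2 with hE_def
  have hE : 0 ≤ E := Finset.sum_nonneg fun i _ => by positivity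
  have hi : ∀ i, ‖(w i).2‖ ≤ Real.sqrt E := fun i => by
    rw [← Real.sqrt_sq (norm_nonneg (w i).2)]
    exact Real.sqrt_le_sqrt (Finset.single_le_sum (f := fun j => ‖(w j).2‖ ^ 2)
      (fun j _ => by positivity) (Finset.mem_univ i))
  have hpoly : (1 + Real.sqrt E) ^ 3 ≤ 3 + 5 * E + E ^ 2 := by
    have hs : Real.sqrt E ^ 2 = E := Real.sq_sqrt hE
    have h3 : Real.sqrt E ^ 3 = Real.sqrt E * E := by rw [show (3 : ℕ) = 2 + 1 from rfl, pow_succ, hs, mul_comm]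
    have h4 : Real.sqrt E ^ 4 = E ^ 2 := by rw [show (4 : ℕ) = 2 * 2 from rfl, pow_mul, hs]
    nlinarith [mul_nonneg (sq_nonneg (Real.sqrt E - 1)) (add_nonneg (sq_nonneg (Real.sqrt E)) zero_le_three),
      Real.sqrt_nonneg E, sq_nonneg E]
  calc |DgSum T a θ u r w| ≤ ∑ i, |DgExp T a θ u r (w i)| := Finset.abs_sum_le_sum_abs _ _
    _ ≤ ∑ _i : Fin (N + 1), C * (1 + Real.sqrt E) ^ 3 := Finset.sum_le_sum fun i _ =>
        (hC (w i)).trans (by gcongr; exact hi i)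
    _ = ((N : ℝ) + 1) * C * (1 + Real.sqrt E) ^ 3 := by
        simp only [Finset.sum_const, Finset.card_univ, Fintype.card_fin, nsmul_eq_mul, Nat.cast_add, Nat.cast_one]
        ring
    _ ≤ ((N : ℝ) + 1) * C * (3 + 5 * E + E ^ 2) := by gcongr

end Streaming

/-! ## §3 The collision sum of the pair kernel is measurable in the datum -/

section Collisions

variable {T : ℝ} {θ : ℝ → T3 → ℝ} {u : ℝ → T3 → V3}

/-- The pair kernel read off the collision mark `(t, x, ω, v, w)`: time clamped to the window `[s, s+h]`, partner
position `x − proj(ε ω)`, post-collisional velocity `v − ⟪v − w, ω⟫ ω`. [folklore] -/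
def markKernel (θ : ℝ → T3 → ℝ) (u : ℝ → T3 → V3) (ε s h : ℝ) (m : ℝ × T3 × V3 × V3 × V3) : ℝ :=
  ((∑ k : Fin 3, (u (max s (min m.1 (s + h))) m.2.1 k / θ (max s (min m.1 (s + h))) m.2.1 -
        u (max s (min m.1 (s + h))) (m.2.1 - Torus.proj (ε • m.2.2.1)) k /
          θ (max s (min m.1 (s + h))) (m.2.1 - Torus.proj (ε • m.2.2.1))) *
      ((m.2.2.2.1 - ⟪m.2.2.2.1 - m.2.2.2.2, m.2.2.1⟫_ℝ • m.2.2.1) k - m.2.2.2.1 k)) -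
    ((θ (max s (min m.1 (s + h))) m.2.1)⁻¹ - (θ (max s (min m.1 (s + h))) (m.2.1 - Torus.proj (ε • m.2.2.1)))⁻¹) *
      ((‖m.2.2.2.1 - ⟪m.2.2.2.1 - m.2.2.2.2, m.2.2.1⟫_ℝ • m.2.2.1‖ ^ 2 - ‖m.2.2.2.1‖ ^ 2) / 2)) / 2

/-- Continuity template for the mark kernel with abstract continuous coefficient fields. [folklore] -/
theorem continuous_markKernel_aux {Uc : ℝ × T3 → V3} {Θc : ℝ × T3 → ℝ} {Pr : V3 → T3}
    (hU : Continuous Uc) (hΘ : Continuous Θc) (hΘ0 : ∀ p, Θc p ≠ 0) (hP : Continuous Pr) :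
    Continuous fun m : ℝ × T3 × V3 × V3 × V3 =>
      ((∑ k : Fin 3, (Uc (m.1, m.2.1) k / Θc (m.1, m.2.1) -
            Uc (m.1, m.2.1 - Pr m.2.2.1) k / Θc (m.1, m.2.1 - Pr m.2.2.1)) *
          ((m.2.2.2.1 - ⟪m.2.2.2.1 - m.2.2.2.2, m.2.2.1⟫_ℝ • m.2.2.1) k - m.2.2.2.1 k)) -
        ((Θc (m.1, m.2.1))⁻¹ - (Θc (m.1, m.2.1 - Pr m.2.2.1))⁻¹) *
          ((‖m.2.2.2.1 - ⟪m.2.2.2.1 - m.2.2.2.2, m.2.2.1⟫_ℝ • m.2.2.1‖ ^ 2 - ‖m.2.2.2.1‖ ^ 2) / 2)) / 2 := by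
  have h1 : ∀ m : ℝ × T3 × V3 × V3 × V3, Θc (m.1, m.2.1) ≠ 0 := fun m => hΘ0 _
  have h2 : ∀ m : ℝ × T3 × V3 × V3 × V3, Θc (m.1, m.2.1 - Pr m.2.2.1) ≠ 0 := fun m => hΘ0 _
  fun_prop (disch := assumption)

/-- **The mark kernel is continuous** (profiles jointly smooth on `[0, T) ⊇ [s, s+h]`, `θ > 0`; the clamped fields
are continuous on `ℝ × T³` since `id × proj` is an open quotient map). [folklore] -/
theorem continuous_markKernel (hθ : Torus.IsSmoothSpaceTimeOn (Ico 0 T) θ)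
    (hu : Torus.IsSmoothSpaceTimeOn (Ico 0 T) u) (hθ0 : ∀ t ∈ Ico 0 T, ∀ x, 0 < θ t x) {s h : ℝ}
    (hs : 0 ≤ s) (hh : 0 ≤ h) (hshT : s + h < T) (ε : ℝ) : Continuous (markKernel θ u ε s h) := by
  set c : ℝ → ℝ := fun t => max s (min t (s + h)) with hc_def
  have hcm : ∀ t, c t ∈ Ico 0 T := fun t =>
    ⟨hs.trans (le_max_left _ _), (max_le (le_add_of_nonneg_right hh) (min_le_right _ _)).trans_lt hshT⟩
  have hq : IsOpenQuotientMap (Prod.map id Torus.proj : ℝ × V3 → ℝ × T3) :=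
    IsOpenQuotientMap.id.prodMap Torus.isOpenQuotientMap_proj
  have hlift : Continuous fun p : ℝ × V3 => (c p.1, p.2) := by fun_prop
  have hUc : Continuous fun p : ℝ × T3 => u (c p.1) p.2 := hq.continuous_comp_iff.1
    (hu.continuousOn_stLift.comp_continuous hlift fun p => mk_mem_prod (hcm p.1) (mem_univ _))
  have hΘc : Continuous fun p : ℝ × T3 => θ (c p.1) p.2 := hq.continuous_comp_iff.1
    (hθ.continuousOn_stLift.comp_continuous hlift fun p => mk_mem_prod (hcm p.1) (mem_univ _))
  exact continuous_markKernel_aux (Uc := fun p : ℝ × T3 => u (c p.1) p.2) (Θc := fun p : ℝ × T3 => θ (c p.1) p.2)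
    (Pr := fun ω : V3 => Torus.proj (ε • ω)) hUc hΘc (fun p => (hθ0 _ (hcm p.1) _).ne')
    (Torus.continuous_proj.comp (continuous_const_smul ε))

variable {N : ℕ} {ε : ℝ}

/-- **On an actual collision the pair kernel is the mark kernel of the mark**: the time lies in the window, the
partner sits at `x_fst − proj(ε ω)` (`proj ∘ reprSym = id`), and `v_fst⁺ = v − ⟪v − w, ω⟫ ω`
(`IsHardSphereTrajectory.vel_eq_preVel_sub_inner_smul_impactVec`). [folklore] -/
theorem pairKernel_eq_markKernel {γ : ℝ → Config (N + 1) (Fin 3) T3}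
    (hγ : IsHardSphereTrajectory (Torus.geometry (Fin 3)) ε (N + 1) γ) (hε : ε < 2⁻¹) (hε0 : ε ≠ 0)
    {s h t : ℝ} (ht : t ∈ Icc s (s + h)) {p : Fin (N + 1) × Fin (N + 1)}
    (hp : p ∈ contactPairs (Torus.geometry (Fin 3)) ε (γ t)) :
    pairKernel θ u (HardSphereCollisionRecord.ofConfig (Torus.geometry (Fin 3)) ε (γ t) t p.1 p.2) =
      markKernel θ u ε s h (HardSphereCollisionRecord.ofConfig (Torus.geometry (Fin 3)) ε (γ t) t p.1 p.2).mark := by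
  obtain ⟨i, j⟩ := p
  have hclamp : max s (min t (s + h)) = t := by rw [min_eq_left ht.2, max_eq_right ht.1]
  have hpost := hγ.vel_eq_preVel_sub_inner_smul_impactVec (Torus.isHardSphereRegular_geometry hε) hp
  have hsnd : (γ t j).1 = (γ t i).1 -
      Torus.proj (ε • (HardSphereCollisionRecord.ofConfig (Torus.geometry (Fin 3)) ε (γ t) t i j).impactVec) := by
    rw [HardSphereCollisionRecord.ofConfig_impactVec, smul_smul, mul_inv_cancel₀ hε0, one_smul,
      Torus.geometry_sepVec, Torus.proj_reprSym, sub_sub_cancel]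
  simp only [markKernel, pairKernel, HardSphereCollisionRecord.mark_def, HardSphereCollisionRecord.ofConfig_time,
    HardSphereCollisionRecord.ofConfig_fstPos, HardSphereCollisionRecord.ofConfig_sndPos,
    HardSphereCollisionRecord.ofConfig_postVel, hclamp]
  rw [← hsnd, ← hpost]

/-- **The collision sum of the pair kernel is a.e.-strongly measurable in the datum** under any law carried by the good
set: along a good orbit it is the collision sum of the continuous mark kernel (`aemeasurable_of_eqOn_collisionSum…`). [folklore] -/
theorem aestronglyMeasurable_collisionSum_pairKernel {σ : ℝ} (hσ : 0 < σ) (hσ2 : σ < 1 / 2)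
    (hθ : Torus.IsSmoothSpaceTimeOn (Ico 0 T) θ) (hu : Torus.IsSmoothSpaceTimeOn (Ico 0 T) u)
    (hθ0 : ∀ t ∈ Ico 0 T, ∀ x, 0 < θ t x) (N : ℕ)
    (Φ : HardSphereFlow (Torus.geometry (Fin 3)) (hsDiameter σ N) (N + 1)) {s h : ℝ} (hs : 0 ≤ s)
    (hh : 0 ≤ h) (hshT : s + h < T) {μ : Measure (Config (N + 1) (Fin 3) T3)} (hμ : ∀ᵐ z ∂μ, z ∈ Φ.good) :
    AEStronglyMeasurable (Φ.collisionSum (Ioc s (s + h)) (pairKernel θ u)) μ := by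
  have hε : hsDiameter σ N < 2⁻¹ := (hsDiameter_le hσ.le N).trans_lt (hσ2.trans_eq (one_div 2))
  have hε0 : hsDiameter σ N ≠ 0 := (hsDiameter_pos hσ N).ne'
  refine (Φ.aemeasurable_of_eqOn_collisionSum_labels_torus hε (F := fun _ _ => markKernel θ u (hsDiameter σ N) s h)
    (fun _ _ => continuous_markKernel hθ hu hθ0 hs hh hshT _) s (s + h) (fun z hz => ?_) hμ).aestronglyMeasurable
  rw [HardSphereFlow.collisionSum_eq, HardSphereFlow.collisionSum_eq, collisionSum_eq_collisionPairSum,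
    collisionSum_eq_collisionPairSum, collisionPairSum, collisionPairSum]
  refine finsum_mem_congr rfl fun t ht => Finset.sum_congr rfl fun p hp => ?_
  exact pairKernel_eq_markKernel (Φ.isTrajectory z hz) hε hε0 (Ioc_subset_Icc_self ht.2) hp

end Collisions

/-! ## §4 The stub: the window balance -/

/-- **STUB `stub_windowBalance`** (C0) of line `IdeatorTwoSketch` (crux `ClampedCurrentsDock`,
stmt-AtomisticToContinuum-14680): the one-window entropy balance with the time-dependent local Gibbs reference —
explicit entropies at `s + h` and `s` subtracted (the time-zero sum and `log Z_pos(a₀)` cancel), the pathwise identity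
on the good set; `Str` dominated by `(N+1) C (3 + 5E + (N+1) Σ_i |v_i|⁴) h` (cubic growth, energy conservation,
Cauchy–Schwarz, Gaussian moments), `Col = ΔG − Str` a.e. [cite: Yau1991, §2] -/
theorem stub_windowBalance : WindowBalance := by
  intro σ T N Φ a₀ θ₀ u₀ a θ u hσ hσ2 ha₀ hθ₀ hu₀ ha0 hθ0 ha hθ hu ha0' hθ0' s h hs hh hshT
  set P := localGibbsLaw σ a₀ u₀ θ₀ N Φ with hP
  have hσ2' : σ ≤ 1 / 2 := hσ2.le
  haveI : IsProbabilityMeasure P := isProbabilityMeasure_localGibbsLaw ha₀ hθ₀ hu₀ ha0 hθ0 hσ2' N Φ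
  have hgood : ∀ᵐ z ∂P, z ∈ Φ.good := ae_mem_good_localGibbsLaw σ a₀ θ₀ u₀ N Φ
  -- `KL(f_t ‖ ψ_t)` made explicit with the time-`t` slice of the reference, `G_t(Φ_t ·)` integrable
  have key : ∀ {t : ℝ}, t ∈ Ico 0 T → Integrable (fun z => gSum a θ u t (Φ.flow t z)) P ∧
      (klDiv (Φ.lawAt P t) (localGibbsLaw σ (a t) (u t) (θ t) N Φ)).toReal =
        ((∫ z, gSum (fun _ => a₀) (fun _ => θ₀) (fun _ => u₀) 0 z ∂P) - ∫ z, gSum a θ u t (Φ.flow t z) ∂P) +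
          (Real.log (posPartition (a t) (hsDiameter σ N) (N + 1)) -
            Real.log (posPartition a₀ (hsDiameter σ N) (N + 1))) := fun {t} ht => by
    have hac : Continuous (a t) := (ha.isSmooth_slice ht).continuous
    have hθc : Continuous (θ t) := (hθ.isSmooth_slice ht).continuous
    have huc : Continuous (u t) := (hu.isSmooth_slice ht).continuous
    have hGt := integrable_oneBodySum_flow hσ2' ha₀ hθ₀ hu₀ ha0 hθ0 hac hθc huc (ha0' t ht) (hθ0' t ht) N Φ t
    have e := toReal_klDiv_lawAt_eq_integral hσ2' ha₀ hθ₀ hu₀ ha0 hθ0 hac hθc huc (ha0' t ht) (hθ0' t ht) N Φ t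
    rw [integral_sub (integrable_oneBodySum hσ2' ha₀ hθ₀ hu₀ ha0 hθ0 ha₀ hθ₀ hu₀ ha0 hθ0 N Φ) hGt] at e
    exact ⟨hGt, e⟩
  obtain ⟨hG1, e1⟩ := key (t := s + h) ⟨hs.trans (le_add_of_nonneg_right hh), hshT⟩
  obtain ⟨hG0, e0⟩ := key (t := s) ⟨hs, (le_add_of_nonneg_right hh).trans_lt hshT⟩
  -- the pathwise identity on the good set
  have hpath : ∀ z ∈ Φ.good, gSum a θ u (s + h) (Φ.flow (s + h) z) - gSum a θ u s (Φ.flow s z) =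
      (∫ r in s..(s + h), DgSum T a θ u r (Φ.flow r z)) + Φ.collisionSum (Ioc s (s + h)) (pairKernel θ u) z :=
    fun z hz => gSum_sub_eq Φ ha hθ hu ha0' hθ0' hz hs hh hshT
  -- measurability of the collision sum, hence of the streaming integral
  have hColm : AEStronglyMeasurable (Φ.collisionSum (Ioc s (s + h)) (pairKernel θ u)) P :=
    aestronglyMeasurable_collisionSum_pairKernel hσ hσ2 hθ hu hθ0' N Φ hs hh hshT hgood
  have hStrm : AEStronglyMeasurable (fun z => ∫ r in s..(s + h), DgSum T a θ u r (Φ.flow r z)) P := by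
    refine ((hG1.aestronglyMeasurable.sub hG0.aestronglyMeasurable).sub hColm).congr ?_
    filter_upwards [hgood] with z hz
    rw [Pi.sub_apply, Pi.sub_apply, hpath z hz, add_sub_cancel_right]
  -- domination of the streaming integral: cubic growth, energy conservation, second and fourth Gaussian moments
  obtain ⟨C, hC0, hC⟩ := exists_abs_DgExp_le ha hθ hu ha0' hθ0' hs hshT
  have hbound : Integrable (fun z : Config (N + 1) (Fin 3) T3 => ((N : ℝ) + 1) * C *
      (3 + 5 * ∑ i, ‖(z i).2‖ ^ 2 + ((N : ℝ) + 1) * ∑ i, ‖(z i).2‖ ^ 4) * h) P := by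
    refine Integrable.mul_const (Integrable.const_mul (((integrable_const _).add ?_).add ?_) _) _
    · exact (integrable_sum_norm_sq_localGibbsLaw ha₀ hθ₀ hu₀ (fun x => (ha0 x).le) hθ0 σ N Φ).const_mul _
    · exact (integrable_sum_norm_pow_four_localGibbsLaw ha₀ hθ₀ hu₀ (fun x => (ha0 x).le) hθ0 σ N Φ).const_mul _
  have hStr : Integrable (fun z => ∫ r in s..(s + h), DgSum T a θ u r (Φ.flow r z)) P := by
    refine hbound.mono' hStrm ?_
    filter_upwards [hgood] with z hz
    -- energy conservation along the good orbit and Cauchy–Schwarz at time `0`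
    have hEr : ∀ r, ∑ i, ‖(Φ.flow r z i).2‖ ^ 2 = ∑ i, ‖(z i).2‖ ^ 2 := fun r => by
      have hE := IsHardSphereTrajectory.configEnergy_eq_holds (Φ.isTrajectory z hz) r 0
      rw [Φ.flow_zero z hz] at hE
      simpa [configEnergy] using congrArg (fun e : ℝ => 2 * e) hE
    have hCS : (∑ i, ‖(z i).2‖ ^ 2) ^ 2 ≤ ((N : ℝ) + 1) * ∑ i, ‖(z i).2‖ ^ 4 := by
      have h := sq_sum_le_card_mul_sum_sq (s := Finset.univ) (f := fun i : Fin (N + 1) => ‖(z i).2‖ ^ 2)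
      simpa only [Finset.card_univ, Fintype.card_fin, Nat.cast_add, Nat.cast_one, ← pow_mul] using h
    have hK : ∀ r ∈ Set.uIoc s (s + h), ‖DgSum T a θ u r (Φ.flow r z)‖ ≤
        ((N : ℝ) + 1) * C * (3 + 5 * ∑ i, ‖(z i).2‖ ^ 2 + ((N : ℝ) + 1) * ∑ i, ‖(z i).2‖ ^ 4) := by
      intro r hr
      rw [uIoc_of_le (le_add_of_nonneg_right hh)] at hr
      rw [Real.norm_eq_abs]
      refine (abs_DgSum_le hC0 (hC r (Ioc_subset_Icc_self hr)) (Φ.flow r z)).trans ?_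
      rw [hEr r]
      gcongr
    calc ‖∫ r in s..(s + h), DgSum T a θ u r (Φ.flow r z)‖
        ≤ ((N : ℝ) + 1) * C * (3 + 5 * ∑ i, ‖(z i).2‖ ^ 2 + ((N : ℝ) + 1) * ∑ i, ‖(z i).2‖ ^ 4) *
            |s + h - s| := intervalIntegral.norm_integral_le_of_norm_le_const hK
      _ = _ := by rw [add_sub_cancel_left, abs_of_nonneg hh]
  -- the collision sum is the a.e. difference
  have hCol : Integrable (Φ.collisionSum (Ioc s (s + h)) (pairKernel θ u)) P := by
    refine ((hG1.sub hG0).sub hStr).congr ?_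
    filter_upwards [hgood] with z hz
    rw [Pi.sub_apply, Pi.sub_apply, hpath z hz, add_sub_cancel_left]
  -- the identity
  have hSC : ∫ z, ((∫ r in s..(s + h), DgSum T a θ u r (Φ.flow r z)) +
        Φ.collisionSum (Ioc s (s + h)) (pairKernel θ u) z) ∂P =
      (∫ z, gSum a θ u (s + h) (Φ.flow (s + h) z) ∂P) - ∫ z, gSum a θ u s (Φ.flow s z) ∂P := by
    rw [← integral_sub hG1 hG0]
    exact integral_congr_ae (hgood.mono fun z hz => (hpath z hz).symm)
  have hfin : (klDiv (Φ.lawAt P (s + h)) (localGibbsLaw σ (a (s + h)) (u (s + h)) (θ (s + h)) N Φ)).toReal -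
      (klDiv (Φ.lawAt P s) (localGibbsLaw σ (a s) (u s) (θ s) N Φ)).toReal =
      -(∫ z, ((∫ r in s..(s + h), DgSum T a θ u r (Φ.flow r z)) +
          Φ.collisionSum (Ioc s (s + h)) (pairKernel θ u) z) ∂P) +
        (Real.log (posPartition (a (s + h)) (hsDiameter σ N) (N + 1)) -
          Real.log (posPartition (a s) (hsDiameter σ N) (N + 1))) := by
    rw [e1, e0, hSC]
    ring
  exact ⟨hStr, hCol, hfin⟩

end Summit.AtomisticToContinuum.HydrodynamicLimit.Theorems.ClampedCurrentsDockWindowBalance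

end
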